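import Summits.AtomisticToContinuum.Crystallization.Theorems.ReggeStarCoercivityDefectFreeCrystallizesLayeredGluing06
/-!
# Part 7 of the proof of `stub_layeredGluing : LayeredGluing` (S5a, line `prestress-split-korn`, crux stmt-AtomisticToContinuum-13603); see the module docstring of the final part `ReggeStarCoercivityDefectFreeCrystallizesLayeredGluing.lean` for the overview
-/
noncomputable section

open scoped BigOperators Classical InnerProductSpace
open Filter Topology

namespace Summit.AtomisticToContinuum.Crystallization.Theorems.PrestressSplitKorn

open Summit.AtomisticToContinuum.Crystallization.Theses
open Summit.AtomisticToContinuum.Crystallization.Theses.ReggeStarCoercivity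
open Summit.AtomisticToContinuum.Crystallization.Theorems.DefectFreeCrystallizes.Negative.PredicateAPI
open Literature.MathematicalPhysics.StatisticalMechanics Literature.Geometry.DiscreteGeometry

section Sites

variable {a : ℝ} {s : ℤ → ℤ} {z : ℤ → ℝ}

/-- **Antipodal up/down sites force the cubic letter pattern** `s (-1) = s 0` (and opposite
heights). -/
theorem cubic_of_antipodal (hbox : InBox a z) (hs : IsHaggSeq s) {i j i' j' : ℤ}
    (h : layeredPos a s z (-1, i', j') = -layeredPos a s z (1, i, j)) :
    s (-1) = s 0 ∧ z (-1) = -z 1 := by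
  have h2 := congrArg (fun x : EuclideanSpace ℝ (Fin 3) => x 2) h
  simp only [layeredPos_apply_two, PiLp.neg_apply] at h2
  refine ⟨?_, h2⟩
  have h1 := congrArg (fun x : EuclideanSpace ℝ (Fin 3) => x 1) h
  simp only [layeredPos_apply_one, PiLp.neg_apply, haggLabel_neg_one, haggLabel_one, Int.cast_neg] at h1
  have ha := hbox.a_pos
  have h3 : (0 : ℝ) < √3 := by positivity
  have : ((s 0 : ℝ) - (s (-1) : ℝ)) = -3 * (j + j') := by
    have : a * √3 / 2 * ((j' : ℝ) - (s (-1) : ℝ) / 3 + (j + (s 0 : ℝ) / 3)) = 0 := by linarith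
    have hne : a * √3 / 2 ≠ 0 := by positivity
    have := (mul_eq_zero.1 this).resolve_left hne
    linarith
  have hint : s 0 - s (-1) = -3 * (j + j') := by exact_mod_cast this
  rcases hs 0 with h0 | h0 <;> rcases hs (-1) with h1 | h1 <;> omega

/-- Integer solutions of `i² + ij + j² = 3`. -/
theorem int_form_eq_three {i j : ℤ} (h : i ^ 2 + i * j + j ^ 2 = 3) :
    (i, j) = (1, 1) ∨ (i, j) = (-1, -1) ∨ (i, j) = (2, -1) ∨ (i, j) = (-2, 1) ∨ (i, j) = (-1, 2) ∨
      (i, j) = (1, -2) := by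
  have hj : j ^ 2 ≤ 4 := by nlinarith [sq_nonneg (2 * i + j)]
  have hi : i ^ 2 ≤ 4 := by nlinarith [sq_nonneg (2 * j + i)]
  have hj1 : -2 ≤ j ∧ j ≤ 2 := by constructor <;> nlinarith
  have hi1 : -2 ≤ i ∧ i ≤ 2 := by constructor <;> nlinarith
  obtain ⟨hi1, hi2⟩ := hi1
  obtain ⟨hj1, hj2⟩ := hj1
  interval_cases i <;> interval_cases j <;> simp_all

/-- **Thirds of lattice vectors of norm `a/√3` are hole offsets `± w` modulo the lattice.** -/
theorem third_lattice (ha : 0 < a) {x : EuclideanSpace ℝ (Fin 3)} {i j : ℤ}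
    (h3 : (3 : ℝ) • x = (i : ℝ) • triangularVec₁ a + (j : ℝ) • triangularVec₂ a)
    (hn : ‖x‖ ^ 2 = a ^ 2 / 3) :
    ∃ (δ i₀ j₀ : ℤ), (δ = 1 ∨ δ = -1) ∧
      x = (δ : ℝ) • barlowOffset a + ((i₀ : ℝ) • triangularVec₁ a + (j₀ : ℝ) • triangularVec₂ a) := by
  have hform : i ^ 2 + i * j + j ^ 2 = 3 := by
    have h1 : ‖(3 : ℝ) • x‖ ^ 2 = 3 * a ^ 2 := by rw [norm_smul, mul_pow]; norm_num; linarith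
    rw [h3, norm_sq_planar] at h1
    have : ((i : ℝ) ^ 2 + i * j + (j : ℝ) ^ 2) = 3 := by
      have := mul_left_cancel₀ (pow_ne_zero 2 ha.ne') (h1.trans (by ring : 3 * a ^ 2 = a ^ 2 * 3))
      exact this
    exact_mod_cast this
  have hw : (3 : ℝ) • barlowOffset a = triangularVec₁ a + triangularVec₂ a := three_smul_barlowOffset a
  have key : ∀ (δ i₀ j₀ : ℤ), (3 : ℝ) • x = (3 : ℝ) • ((δ : ℝ) • barlowOffset a +
      ((i₀ : ℝ) • triangularVec₁ a + (j₀ : ℝ) • triangularVec₂ a)) →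
      x = (δ : ℝ) • barlowOffset a + ((i₀ : ℝ) • triangularVec₁ a + (j₀ : ℝ) • triangularVec₂ a) :=
    fun δ i₀ j₀ h => smul_right_injective (EuclideanSpace ℝ (Fin 3)) (by norm_num : (3 : ℝ) ≠ 0) h
  rcases int_form_eq_three hform with h | h | h | h | h | h <;>
    simp only [Prod.mk.injEq] at h <;> obtain ⟨rfl, rfl⟩ := h
  · exact ⟨1, 0, 0, Or.inl rfl, key _ _ _ (by rw [h3, smul_add, smul_comm (3:ℝ) ((1:ℤ):ℝ), hw]; push_cast; module)⟩
  · exact ⟨-1, 0, 0, Or.inr rfl, key _ _ _ (by rw [h3, smul_add, smul_comm (3:ℝ) ((-1:ℤ):ℝ), hw]; push_cast; module)⟩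
  · exact ⟨-1, 1, 0, Or.inr rfl, key _ _ _ (by rw [h3, smul_add, smul_comm (3:ℝ) ((-1:ℤ):ℝ), hw]; push_cast; module)⟩
  · exact ⟨1, -1, 0, Or.inl rfl, key _ _ _ (by rw [h3, smul_add, smul_comm (3:ℝ) ((1:ℤ):ℝ), hw]; push_cast; module)⟩
  · exact ⟨-1, 0, 1, Or.inr rfl, key _ _ _ (by rw [h3, smul_add, smul_comm (3:ℝ) ((-1:ℤ):ℝ), hw]; push_cast; module)⟩
  · exact ⟨1, 0, -1, Or.inl rfl, key _ _ _ (by rw [h3, smul_add, smul_comm (3:ℝ) ((1:ℤ):ℝ), hw]; push_cast; module)⟩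

/-! ### Words: scaling and reflection of Hägg labels -/

/-- Auxiliary step `haggLabel_mul_const` of the proof of `stub_layeredGluing` (S5a); see the final part's module docstring. -/
theorem haggLabel_mul_const (c : ℤ) (s : ℤ → ℤ) (m : ℤ) :
    haggLabel (fun k => c * s k) m = c * haggLabel s m := by
  induction m using Int.induction_on with
  | zero => simp
  | succ n ih => rw [haggLabel_succ, ih, haggLabel_succ]; ring
  | pred n ih =>
    have h1 := haggLabel_succ (fun k => c * s k) (-(n : ℤ) - 1)
    have h2 := haggLabel_succ s (-(n : ℤ) - 1)
    rw [show -(n : ℤ) - 1 + 1 = -n by ring] at h1 h2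
    linear_combination ih - h1 + c * h2

/-- Auxiliary step `haggLabel_reflect` of the proof of `stub_layeredGluing` (S5a); see the final part's module docstring. -/
theorem haggLabel_reflect (s : ℤ → ℤ) (n : ℤ) :
    haggLabel (fun k => s (-k - 1)) n = -haggLabel s (-n) := by
  induction n using Int.induction_on with
  | zero => simp
  | succ m ih =>
    rw [haggLabel_succ, ih]
    have h2 := haggLabel_succ s (-((m : ℤ) + 1))
    rw [show -((m : ℤ) + 1) + 1 = -(m : ℤ) by ring] at h2
    have e : s (-(m : ℤ) - 1) = s (-((m : ℤ) + 1)) := by congr 1; ring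
    linarith
  | pred m ih =>
    have h1 := haggLabel_succ (fun k => s (-k - 1)) (-(m : ℤ) - 1)
    rw [show -(m : ℤ) - 1 + 1 = -m by ring] at h1
    have h2 := haggLabel_succ s (m : ℤ)
    have e1 : s (-(-(m : ℤ) - 1) - 1) = s (m : ℤ) := by congr 1; ring
    have e2 : haggLabel s (-(-(m : ℤ) - 1)) = haggLabel s ((m : ℤ) + 1) := by congr 1; ring
    have e3 : haggLabel s (-(-(m : ℤ))) = haggLabel s (m : ℤ) := by congr 1; ring
    rw [e3] at ih
    rw [e2]
    linarith

/-- Auxiliary step `haggLabel_constWord` of the proof of `stub_layeredGluing` (S5a); see the final part's module docstring. -/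
theorem haggLabel_constWord (σ m : ℤ) : haggLabel (fun _ => σ) m = m * σ := by
  induction m using Int.induction_on with
  | zero => simp
  | succ n ih => rw [haggLabel_succ, ih]; ring
  | pred n ih =>
    have h1 := haggLabel_succ (fun _ => σ) (-(n : ℤ) - 1)
    rw [show -(n : ℤ) - 1 + 1 = -n by ring] at h1
    linarith

/-! ### The cubic (fcc) box template -/

/-- Auxiliary step `sqrt_two_thirds_bounds` of the proof of `stub_layeredGluing` (S5a); see the final part's module docstring. -/
theorem sqrt_two_thirds_bounds : (39 / 50 : ℝ) ≤ Real.sqrt (2 / 3) ∧ Real.sqrt (2 / 3) ≤ 17 / 20 := by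
  constructor
  · rw [Real.le_sqrt (by norm_num) (by norm_num)]; norm_num
  · rw [Real.sqrt_le_left (by norm_num)]; norm_num

/-- Auxiliary step `sqrt_two_thirds_sq` of the proof of `stub_layeredGluing` (S5a); see the final part's module docstring. -/
theorem sqrt_two_thirds_sq : Real.sqrt (2 / 3) ^ 2 = 2 / 3 := Real.sq_sqrt (by norm_num)

/-- Auxiliary step `inBox_idealZ` of the proof of `stub_layeredGluing` (S5a); see the final part's module docstring. -/
theorem inBox_idealZ (ha : 47 / 50 ≤ a) (ha1 : a ≤ 1) : InBox a (idealZ a) := by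
  refine ⟨ha, ha1, fun m => ?_⟩
  have hb := sqrt_two_thirds_bounds
  simp only [idealZ]
  push_cast
  constructor <;> nlinarith [hb.1, hb.2]

/-- Auxiliary step `idealZ_zero` of the proof of `stub_layeredGluing` (S5a); see the final part's module docstring. -/
theorem idealZ_zero (a : ℝ) : idealZ a 0 = 0 := by simp [idealZ]

/-- Sites of the cubic template are linear in the label. -/
theorem layeredPos_fcc (a : ℝ) (σ m i j : ℤ) :
    layeredPos a (fun _ => σ) (idealZ a) (m, i, j) =
      (i : ℝ) • triangularVec₁ a + (j : ℝ) • triangularVec₂ a +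
        (m : ℝ) • ((σ : ℝ) • barlowOffset a + (Real.sqrt (2 / 3) * a) • layerNormal 1) := by
  simp only [layeredPos, haggLabel_constWord, idealZ]
  push_cast
  module

/-- The site set of the cubic template is an additive subgroup: closure properties. -/
theorem fcc_add (a : ℝ) (σ : ℤ) (l l' : ℤ × ℤ × ℤ) :
    layeredPos a (fun _ => σ) (idealZ a) l + layeredPos a (fun _ => σ) (idealZ a) l' =
      layeredPos a (fun _ => σ) (idealZ a) (l + l') := by
  obtain ⟨m, i, j⟩ := l
  obtain ⟨m', i', j'⟩ := l'
  simp only [Prod.mk_add_mk, layeredPos_fcc]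
  push_cast
  module

/-- Auxiliary step `fcc_neg` of the proof of `stub_layeredGluing` (S5a); see the final part's module docstring. -/
theorem fcc_neg (a : ℝ) (σ : ℤ) (l : ℤ × ℤ × ℤ) :
    -layeredPos a (fun _ => σ) (idealZ a) l = layeredPos a (fun _ => σ) (idealZ a) (-l) := by
  obtain ⟨m, i, j⟩ := l
  simp only [Prod.neg_mk, layeredPos_fcc]
  push_cast
  module

/-- Auxiliary step `fcc_zsmul` of the proof of `stub_layeredGluing` (S5a); see the final part's module docstring. -/
theorem fcc_zsmul (a : ℝ) (σ : ℤ) (c : ℤ) (l : ℤ × ℤ × ℤ) :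
    (c : ℝ) • layeredPos a (fun _ => σ) (idealZ a) l = layeredPos a (fun _ => σ) (idealZ a) (c • l) := by
  obtain ⟨m, i, j⟩ := l
  simp only [Prod.smul_mk, smul_eq_mul, layeredPos_fcc]
  push_cast
  module

/-- On layers `-1, 0, 1` a cubic-ideal template coincides with the cubic template of letter `s 0`. -/
theorem layeredPos_eq_fcc_of_cubicAt (hz0 : z 0 = 0) (hc : CubicAt a s z) {l : ℤ × ℤ × ℤ}
    (hl : -1 ≤ l.1 ∧ l.1 ≤ 1) : layeredPos a s z l = layeredPos a (fun _ => s 0) (idealZ a) l := by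
  obtain ⟨m, i, j⟩ := l
  obtain ⟨h1, h2⟩ := hl
  simp only at h1 h2
  interval_cases m
  · simp only [layeredPos, haggLabel_neg_one, hc.1, idealZ, hc.2.2]
    push_cast; module
  · simp only [layeredPos, haggLabel_zero, hz0, idealZ]
    push_cast; module
  · simp only [layeredPos, haggLabel_one, idealZ, hc.2.1]
    push_cast; module

/-- Auxiliary step `haggLabel_two` of the proof of `stub_layeredGluing` (S5a); see the final part's module docstring. -/
theorem haggLabel_two (s : ℤ → ℤ) : haggLabel s 2 = s 0 + s 1 := by
  have := haggLabel_succ s 1; rw [show (1:ℤ) + 1 = 2 by norm_num, haggLabel_one] at this; exact this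

/-- Auxiliary step `haggLabel_neg_two` of the proof of `stub_layeredGluing` (S5a); see the final part's module docstring. -/
theorem haggLabel_neg_two (s : ℤ → ℤ) : haggLabel s (-2) = -s (-1) - s (-2) := by
  have := haggLabel_succ s (-2)
  rw [show (-2 : ℤ) + 1 = -1 by norm_num, haggLabel_neg_one] at this
  linarith

/-- On layers `-2 … 2` a fully ideal template coincides with the cubic template of letter `s 0`. -/
theorem layeredPos_eq_fcc_of_fullyCubic (hz0 : z 0 = 0) (hc : FullyCubic a s z) {l : ℤ × ℤ × ℤ}
    (hl : -2 ≤ l.1 ∧ l.1 ≤ 2) : layeredPos a s z l = layeredPos a (fun _ => s 0) (idealZ a) l := by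
  obtain ⟨m, i, j⟩ := l
  obtain ⟨h1, h2⟩ := hl
  simp only at h1 h2
  rcases (show m = -2 ∨ m = 2 ∨ (-1 ≤ m ∧ m ≤ 1) by omega) with rfl | rfl | hm
  · simp only [layeredPos, haggLabel_neg_two, hc.1.1, hc.2.2.1, idealZ, hc.2.2.2.2]
    push_cast; module
  · simp only [layeredPos, haggLabel_two, hc.2.1, idealZ, hc.2.2.2.1]
    push_cast; module
  · exact layeredPos_eq_fcc_of_cubicAt hz0 hc.1 hm

/-- Sites at layer distance `≥ 3` are outside the open 2-ball. -/
theorem two_le_norm_of_three_le (hbox : InBox a z) (hz0 : z 0 = 0) {l : ℤ × ℤ × ℤ} (hl : 3 ≤ |l.1|) :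
    2 ≤ ‖layeredPos a s z l‖ := by
  have h1 := (hbox.abs_z_le hz0 l.1).2
  have h2 : |z l.1| ≤ ‖layeredPos a s z l‖ := by
    have := (show |(layeredPos a s z l) 2| ≤ ‖layeredPos a s z l‖ by simpa only [Real.norm_eq_abs] using PiLp.norm_apply_le (layeredPos a s z l) 2)
    rwa [show layeredPos a s z l 2 = z l.1 from by obtain ⟨m, i, j⟩ := l; exact layeredPos_apply_two a s z _]
      at this
  have h3 : (3 : ℝ) ≤ |(l.1 : ℝ)| := by rw [← Int.cast_abs]; exact_mod_cast hl
  linarith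

/-! ### Re-expression of a template through a lattice-preserving isometry -/

/-- Auxiliary step `norm_sq_barlowOffset` of the proof of `stub_layeredGluing` (S5a); see the final part's module docstring. -/
theorem norm_sq_barlowOffset (a : ℝ) : ‖barlowOffset a‖ ^ 2 = a ^ 2 / 3 := by
  have := norm_sq_offset a 1 0 (Or.inl rfl)
  simpa using this

/-- **Re-expression.** If the linear isometry `E` and its inverse map the layer generators `u, v`
into the layer lattice and `E e₃ = ε e₃` (`ε = ±1`), then the image under `E` of any box template
`(a, s', z')` is again an identity-framed box template `(a, s'', z'')` (same site set). -/
theorem reexpress (E : EuclideanSpace ℝ (Fin 3) ≃ₗᵢ[ℝ] (EuclideanSpace ℝ (Fin 3))) {a : ℝ} (ha : 0 < a)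
    (hEu : ∃ i j : ℤ, E (triangularVec₁ a) = (i : ℝ) • triangularVec₁ a + (j : ℝ) • triangularVec₂ a)
    (hEv : ∃ i j : ℤ, E (triangularVec₂ a) = (i : ℝ) • triangularVec₁ a + (j : ℝ) • triangularVec₂ a)
    (hEu' : ∃ i j : ℤ, E.symm (triangularVec₁ a) = (i : ℝ) • triangularVec₁ a + (j : ℝ) • triangularVec₂ a)
    (hEv' : ∃ i j : ℤ, E.symm (triangularVec₂ a) = (i : ℝ) • triangularVec₁ a + (j : ℝ) • triangularVec₂ a)
    {ε : ℝ} (hε : ε = 1 ∨ ε = -1) (hEe : E (layerNormal 1) = ε • layerNormal 1)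
    {s' : ℤ → ℤ} {z' : ℤ → ℝ} (hbox' : InBox a z') (hs' : IsHaggSeq s') (hz0' : z' 0 = 0) :
    ∃ (s'' : ℤ → ℤ) (z'' : ℤ → ℝ), InBox a z'' ∧ IsHaggSeq s'' ∧ z'' 0 = 0 ∧
      (∀ l', ∃ l'', E (layeredPos a s' z' l') = layeredPos a s'' z'' l'') ∧
      (∀ l'', ∃ l', layeredPos a s'' z'' l'' = E (layeredPos a s' z' l')) := by
  obtain ⟨i₁, j₁, hu⟩ := hEu
  obtain ⟨i₂, j₂, hv⟩ := hEv
  obtain ⟨i₃, j₃, hu'⟩ := hEu'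
  obtain ⟨i₄, j₄, hv'⟩ := hEv'
  -- `E w = δ w + λ₀`
  have h3w : (3 : ℝ) • E (barlowOffset a) =
      ((i₁ + i₂ : ℤ) : ℝ) • triangularVec₁ a + ((j₁ + j₂ : ℤ) : ℝ) • triangularVec₂ a := by
    rw [← LinearIsometryEquiv.map_smul, three_smul_barlowOffset, map_add, hu, hv]
    push_cast; module
  have hnw : ‖E (barlowOffset a)‖ ^ 2 = a ^ 2 / 3 := by
    rw [LinearIsometryEquiv.norm_map, norm_sq_barlowOffset]
  obtain ⟨δ, i₀, j₀, hδ, hw⟩ := third_lattice ha h3w hnw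
  have symm_formula : ∀ I J : ℤ, E.symm ((I : ℝ) • triangularVec₁ a + (J : ℝ) • triangularVec₂ a) =
      ((I * i₃ + J * i₄ : ℤ) : ℝ) • triangularVec₁ a + ((I * j₃ + J * j₄ : ℤ) : ℝ) • triangularVec₂ a := by
    intro I J
    simp only [map_add, LinearIsometryEquiv.map_smul, hu', hv']
    push_cast; module
  -- the image of a general site
  have formula : ∀ m i j : ℤ, E (layeredPos a s' z' (m, i, j)) =
      ((i * i₁ + j * i₂ + haggLabel s' m * i₀ : ℤ) : ℝ) • triangularVec₁ a +
        ((i * j₁ + j * j₂ + haggLabel s' m * j₀ : ℤ) : ℝ) • triangularVec₂ a +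
        ((δ * haggLabel s' m : ℤ) : ℝ) • barlowOffset a + (ε * z' m) • layerNormal 1 := by
    intro m i j
    simp only [layeredPos, map_add, LinearIsometryEquiv.map_smul, hu, hv, hw, hEe]
    push_cast; module
  -- the preimage of a lattice vector followed by `E`
  have back : ∀ (m I J : ℤ) (L : ℤ), L = haggLabel s' m →
      E (layeredPos a s' z' (m, (I - L * i₀) * i₃ + (J - L * j₀) * i₄, (I - L * i₀) * j₃ + (J - L * j₀) * j₄)) =
        (I : ℝ) • triangularVec₁ a + (J : ℝ) • triangularVec₂ a +
          ((δ * L : ℤ) : ℝ) • barlowOffset a + (ε * z' m) • layerNormal 1 := by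
    intro m I J L hL
    have key : E ((((I - L * i₀) * i₃ + (J - L * j₀) * i₄ : ℤ) : ℝ) • triangularVec₁ a +
        (((I - L * i₀) * j₃ + (J - L * j₀) * j₄ : ℤ) : ℝ) • triangularVec₂ a) =
        ((I - L * i₀ : ℤ) : ℝ) • triangularVec₁ a + ((J - L * j₀ : ℤ) : ℝ) • triangularVec₂ a := by
      rw [← symm_formula, LinearIsometryEquiv.apply_symm_apply]
    simp only [layeredPos]
    rw [map_add, map_add, key, LinearIsometryEquiv.map_smul, LinearIsometryEquiv.map_smul, hw, hEe, ← hL]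
    push_cast; module
  rcases hε with rfl | rfl
  · -- `ε = 1`: same layer indices, letters multiplied by `δ`
    refine ⟨fun k => δ * s' k, z', hbox', ?_, hz0', ?_, ?_⟩
    · intro k
      rcases hs' k with h | h <;> rcases hδ with rfl | rfl <;> simp [h]
    · rintro ⟨m, i, j⟩
      refine ⟨(m, i * i₁ + j * i₂ + haggLabel s' m * i₀, i * j₁ + j * j₂ + haggLabel s' m * j₀), ?_⟩
      rw [formula]
      simp only [layeredPos, haggLabel_mul_const]
      push_cast; module
    · rintro ⟨m, I, J⟩
      refine ⟨(m, (I - haggLabel s' m * i₀) * i₃ + (J - haggLabel s' m * j₀) * i₄,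
        (I - haggLabel s' m * i₀) * j₃ + (J - haggLabel s' m * j₀) * j₄), ?_⟩
      rw [back m I J _ rfl]
      simp only [layeredPos, haggLabel_mul_const]
      push_cast; module
  · -- `ε = -1`: layer indices reflected
    refine ⟨fun k => -δ * s' (-k - 1), fun m => -z' (-m), ?_, ?_, by simp [hz0'], ?_, ?_⟩
    · refine ⟨hbox'.1, hbox'.2.1, fun m => ?_⟩
      have := hbox'.2.2 (-m - 1)
      rw [show -m - 1 + 1 = -m by ring] at this
      show 39 / 50 * a ≤ -z' (-(m + 1)) - -z' (-m) ∧ -z' (-(m + 1)) - -z' (-m) ≤ 17 / 20 * a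
      rw [show -(m + 1) = -m - 1 by ring]
      constructor <;> linarith [this.1, this.2]
    · intro k
      rcases hs' (-k - 1) with h | h <;> rcases hδ with rfl | rfl <;> simp [h]
    · rintro ⟨m, i, j⟩
      refine ⟨(-m, i * i₁ + j * i₂ + haggLabel s' m * i₀, i * j₁ + j * j₂ + haggLabel s' m * j₀), ?_⟩
      rw [formula]
      have hL : haggLabel (fun k => -δ * s' (-k - 1)) (-m) = δ * haggLabel s' m := by
        rw [haggLabel_mul_const, haggLabel_reflect, neg_neg]; ring
      simp only [layeredPos, hL, neg_neg]
      push_cast; module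
    · rintro ⟨m, I, J⟩
      refine ⟨(-m, (I - haggLabel s' (-m) * i₀) * i₃ + (J - haggLabel s' (-m) * j₀) * i₄,
        (I - haggLabel s' (-m) * i₀) * j₃ + (J - haggLabel s' (-m) * j₀) * j₄), ?_⟩
      rw [back (-m) I J _ rfl]
      have hL : haggLabel (fun k => -δ * s' (-k - 1)) m = δ * haggLabel s' (-m) := by
        rw [haggLabel_mul_const, haggLabel_reflect]; ring
      simp only [layeredPos, hL]
      push_cast; module

/-! ### The twelve neighbour labels as one Finset -/

/-- Auxiliary step `mem_nbrLabels` of the proof of `stub_layeredGluing` (S5a); see the final part's module docstring. -/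
theorem mem_nbrLabels {l : ℤ × ℤ × ℤ} :
    l ∈ nbrLabels s ↔ l ∈ hexLabels ∨ l ∈ upLabels (s 0) ∨ l ∈ downLabels (s (-1)) := by
  simp [nbrLabels, Finset.mem_union]

/-- Auxiliary step `card_nbrLabels` of the proof of `stub_layeredGluing` (S5a); see the final part's module docstring. -/
theorem card_nbrLabels (hs : IsHaggSeq s) : (nbrLabels s).card = 12 := by
  have h1 : Disjoint hexLabels (upLabels (s 0)) := by
    rw [Finset.disjoint_left]; intro l hl hl'
    have := hexLabels_fst hl; rw [upLabels_fst hl'] at this; omega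
  have h2 : Disjoint (hexLabels ∪ upLabels (s 0)) (downLabels (s (-1))) := by
    rw [Finset.disjoint_left]; intro l hl hl'
    have h3 := downLabels_fst hl'
    rcases Finset.mem_union.1 hl with h | h
    · have := hexLabels_fst h; omega
    · have := upLabels_fst h; omega
  rw [nbrLabels, Finset.card_union_of_disjoint h2, Finset.card_union_of_disjoint h1,
    card_upLabels (hs 0), card_downLabels (hs (-1))]
  rfl

/-- Auxiliary step `nbrLabels_ne_zero` of the proof of `stub_layeredGluing` (S5a); see the final part's module docstring. -/
theorem nbrLabels_ne_zero {l : ℤ × ℤ × ℤ} (hl : l ∈ nbrLabels s) : l ≠ 0 := by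
  intro h0
  subst h0
  rcases mem_nbrLabels.1 hl with h | h | h
  · revert h; decide
  · have := upLabels_fst h; simp at this
  · have := downLabels_fst h; simp at this

/-- Auxiliary step `nbrLabels_fst_le` of the proof of `stub_layeredGluing` (S5a); see the final part's module docstring. -/
theorem nbrLabels_fst_le {l : ℤ × ℤ × ℤ} (hl : l ∈ nbrLabels s) : -1 ≤ l.1 ∧ l.1 ≤ 1 := by
  rcases mem_nbrLabels.1 hl with h | h | h
  · rw [hexLabels_fst h]; norm_num
  · rw [upLabels_fst h]; norm_num
  · rw [downLabels_fst h]; norm_num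

/-- Neighbour sites have norm in `[a/2, 21/20]` (indeed `a/√3 ≤ ‖·‖ ≤ 1.03`). -/
theorem norm_nbrSite (hbox : InBox a z) (hs : IsHaggSeq s) (hz0 : z 0 = 0) {l : ℤ × ℤ × ℤ}
    (hl : l ∈ nbrLabels s) : a / 2 ≤ ‖layeredPos a s z l‖ ∧ ‖layeredPos a s z l‖ ≤ 21 / 20 := by
  have ha := hbox.1
  have ha1 := hbox.2.1
  rcases mem_nbrLabels.1 hl with h | h | h
  · rw [norm_hexSite hbox hz0 h]; constructor <;> linarith
  · have hsq := norm_sq_upSite (a := a) (z := z) hs h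
    have hz1 := hbox.z_one hz0
    have hn := norm_nonneg (layeredPos a s z l)
    constructor <;> nlinarith [hz1.1, hz1.2]
  · have hsq := norm_sq_downSite (a := a) (z := z) hs h
    have hz1 := hbox.z_neg_one hz0
    have hn := norm_nonneg (layeredPos a s z l)
    constructor <;> nlinarith [hz1.1, hz1.2]

/-! ## The generic step: a half-known identity-framed structure plus any template gives a framing -/

section GenericStep

variable {Y : Set (EuclideanSpace ℝ (Fin 3))} {q : EuclideanSpace ℝ (Fin 3)} {E : EuclideanSpace ℝ (Fin 3) ≃ₗᵢ[ℝ] (EuclideanSpace ℝ (Fin 3))} {a' : ℝ} {s' : ℤ → ℤ} {z' : ℤ → ℝ}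

/-- Landing anchor of this file (registered stub of crux stmt-AtomisticToContinuum-13603; re-exports a result above). -/
theorem layeredGluing_part07_anchor :
    ∀ (σ m : ℤ), haggLabel (fun _ => σ) m = m * σ :=
  haggLabel_constWord

end GenericStep
end Sites

end Summit.AtomisticToContinuum.Crystallization.Theorems.PrestressSplitKorn
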